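import Mathlib.Algebra.BigOperators.Group.Finset.Basic
import Mathlib.Data.Nat.Choose.Basic
import Mathlib.Tactic

/-!
# PercRepro — the numerals of the confinement count at `n = 31`, `d = 9` (p8 g13, S3): `Σ_{b ≤ 9 − ν} C(31 − σ, b)·C(σ, 6 − b)`
over the admissible `(ν, σ)` grid `ν₀ ≤ ν ≤ 9`, `σ ≤ 3ν`, `σ ≤ 31` — the coloop-free cell `(22, 9)`, branches `s₃ = 10` (`ν₀ = 6`),
`s₃ = 11` (`ν₀ = 7`), `12 ≤ s₃ ≤ 13` (`ν₀ = 8`). Each bound is the exact maximum over the grid. Axioms: standard.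
-/

namespace PercRepro

namespace ThmN

/-- The confinement count at `n = 31`, `d = 9`, `ν ≥ 6`, `σ ≤ 3ν`: at most `602004`. -/
theorem confined_bound_31_9_6 (ν σ : ℕ) (hν0 : 6 ≤ ν) (hν9 : ν ≤ 9) (hσ : σ ≤ 3 * ν) (hσn : σ ≤ 31) :
    ∑ b ∈ Finset.range (9 - ν + 1), (31 - σ).choose b * σ.choose (6 - b) ≤ 602004 := by
  interval_cases ν <;> interval_cases σ <;> norm_num [Finset.sum_range_succ, Nat.choose]

/-- The confinement count at `n = 31`, `d = 9`, `ν ≥ 7`, `σ ≤ 3ν`: at most `527079`. -/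
theorem confined_bound_31_9_7 (ν σ : ℕ) (hν0 : 7 ≤ ν) (hν9 : ν ≤ 9) (hσ : σ ≤ 3 * ν) (hσn : σ ≤ 31) :
    ∑ b ∈ Finset.range (9 - ν + 1), (31 - σ).choose b * σ.choose (6 - b) ≤ 527079 := by
  interval_cases ν <;> interval_cases σ <;> norm_num [Finset.sum_range_succ, Nat.choose]

/-- The confinement count at `n = 31`, `d = 9`, `ν ≥ 8`, `σ ≤ 3ν`: at most `432124`. -/
theorem confined_bound_31_9_8 (ν σ : ℕ) (hν0 : 8 ≤ ν) (hν9 : ν ≤ 9) (hσ : σ ≤ 3 * ν) (hσn : σ ≤ 31) :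
    ∑ b ∈ Finset.range (9 - ν + 1), (31 - σ).choose b * σ.choose (6 - b) ≤ 432124 := by
  interval_cases ν <;> interval_cases σ <;> norm_num [Finset.sum_range_succ, Nat.choose]

end ThmN

end PercRepro
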